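import Summits.Ventures.CertifiedManyBodySolver.Observables.RungLeavesCoverageLa214M2c
import Summits.Ventures.CertifiedManyBodySolver.Certificates.HubbardSquare_boxword_cuprateFamily_xl_devices
import HarnessLib

/-!
# M2(c) «LSCO x = 1/8» — the BOX-READ typing: density-affine (`WN`) BUNDLE claim-node SHAPE, its orbit-lower family, and the
# parametric closer of `La214M2c_StiffnessBoxCeiling` from FOUR end-objective station bundles

Venture CertifiedManyBodySolver; cell `hubbard-obs` / D-0154 (1)(C) COVERAGE (La214 = TEMPLATE material, «LSCO x = 1/8» depth); seat
`hubbard-cov-la214-box-2` (`prover-hubbard-cov-la214-box-2-0`; KEY «…-box-1…2 = window typing + boxdual/0 exact reader per corner, claim nodes»;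
hubbard-obs RULING (nnn) d310 (nnn3) «M2(c) ↔ {unc-3 (C) leaf, box-2, sdp-2}»; hubbard-cov-la214-plan-1 GAP (L5) «M2(c) per-corner reader / claim nodes»).
Namespace `Summit.Ventures.CertifiedManyBodySolver.Downfold`. The M2(b) (`n = 1`) sister is hubbard-cov-la214-box-1's `Downfold/BoxesLa214V115M2bBoxRead.lean`
(`TPrimeBundleOrbitLowerRow`: a two-vertex `t′`-bundle certified at ONE density). The doped box `boxLa214E_M15v115` (`n ∈ [171/200, 179/200]`) needs the
SAME bundle read AT EVERY DENSITY of the M15 bar; the only source of density dependence a certificate offers is its own density multiplier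
(`Rows/DopedTLCorrFilling`: `SquareTTPrimeCorrOrbitLowerRowWN`, value `r + s·(x − n₀)` under FIXED window rows `lo ≤ e₀(x) ≤ hi`). Hence:

* §0 `wnBundleValue F sl₁ sl₂ n₀ x = F + min(sl₁·(x − n₀), sl₂·(x − n₀))` — what a two-vertex bundle solved at `n₀` certifies at density `x`
  UNIFORMLY in the bundle parameter: the interpolated dual `y(w) = (1−w)·y_v + w·y_u` has bound `Q(w) + ((1−w)·sl_v + w·sl_u)·(x − n₀) ≥ F0 + min(sl_v, sl_u)(x − n₀)`
  (`F0` = boxdual's uniform floor of `Q`, BOXDUAL-FORMAT §1 / D2A §1; the density rows are equalities, so `y(w)` stays dual-feasible when their rhs moves and the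
  bound moves by the interpolated density multiplier — weak duality, [cite: BoydVandenberghe2004, §5.9]); price lemma `neg_wnBundleValue_le_of_ends` (the value is
  concave piecewise-affine in `x`, so `−value ≤ c` on a filling slab iff it holds at the slab ends for both slopes — four rational inequalities).
* §1 SHAPE `TPrimeBundleOrbitLowerRowWN U s₁ s₂ lo hi F sl₁ sl₂ n₀ X`: for EVERY `s ∈ [s₁, s₂]` and EVERY density `x ∈ [0, 2)`, GIVEN the bundle's CONSTANT
  window rows `lo ≤ e₀(1, s, U, x) ≤ hi` (declared cell functions constant on the bundle: ONE cap literal — caps do not chord in `t′`, D2A §2.4 — and ONE floor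
  literal = the smaller vertex floor, a floor on the whole segment by concavity in `t′`; floors are idle in f-sum legs, obs-p2 2026-08-28 04:45Z), the orbit-mean
  LOWER row `wnBundleValue F sl₁ sl₂ n₀ x ≤ |D₄|⁻¹ Σ_γ Re ω_γ(Γ_γ (X s))` on the torus-limit ground-state class at `(s, U, x)`. READER CONTRACT (what the
  «boxdual/0 exact reader per corner» prints per bundle per objective, exact ℚ): `F` (= F0), `sl₁`, `sl₂` (the two vertex density slopes `Σ_σ μ_σ/2`), the
  literals `lo`, `hi` both vertex files carry, `n₀`, bundle sha256 + reader version.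
* §2 `.orbitLowerOn`: SHAPE + the window DISCHARGED on `[s₁, s₂] × [xlo, xhi]` (theorems about `e₀`, by name — e.g. this seat's
  `Certificates/HubbardSquare_LSCO_n7o8_station29o5_apriori_windows{,_slabFloors,_slab}`: `u29o5_slab_stationSegment_cap_of` gives ONE `hi` for every
  `s ∈ [−11/20, −1/5]`, the `…_slab_<vertex>_floor_of` the vertex floors) ⇒ the unconditional two-parameter family on the slab.
* §3 THE M2(c) CLOSER `La214M2c_StiffnessBoxCeiling_of_fourBundleRowsWN`: station `U_A = 29/5`, `n₀ = 7/8`, the two END objectives `P = −X₀(−3/10, 29/5)`,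
  `Q = −X₀(−1/5, 29/5)` (unc-2 g15 «no K₂ word for doped boxes»; each vertex solve READ WITH BOTH objectives), each bundled on the OVERHANG `[−357/740, −3/10]`
  and the INNER segment `[−3/10, −1/5]` ⇒ four rows `(F, sl₁, sl₂)_{Po, Pi, Qo, Qi}`; window hypotheses as ∀-statements; SIXTEEN rational price inequalities
  `−F_b − sl_bj·(x_e − 7/8) ≤ c` (`x_e ∈ {171/200, 179/200}`); `c ≤ 4017332/10⁷` (unc-3's PROPOSED bar, `Observables/RungLeavesCoverageLa214M2c`) ⇒
  `La214M2c_StiffnessBoxCeiling` via `La214M2c_StiffnessBoxCeiling_of_apexStation29o5_twoEndObjectives` with the piecewise families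
  `vP x s = if s ≤ −3/10 then value_Po x else value_Pi x` (likewise `vQ`). The day the four reads print: four `@[conjecture] def` nodes of the §1 shape + ONE `exact`.

HONEST FRAMING: obligation SHAPES and a CONDITIONAL closer — nothing is asserted; no number of record; no certificate exists yet for any M2(c) leg (hubbard-obs
(nnn5): the legs fire only after a typed cap object — `u29o5_n7o8_tp_faceCap_of`, p607630). Words so closed are one-sided stiffness CEILINGS of CONTROL /
CALIBRATION class (+ labelled Mott-proximity HEURISTIC) on a downfolded, screening-grade one-band box; a ceiling never speaks to the presence of
superconductivity; never «certified true negative / positive»; not a `T_c` or phase sentence; nothing here is a statement about La₁.₈₇₅Sr₀.₁₂₅CuO₄.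

References: S. Boyd, L. Vandenberghe, *Convex Optimization* (2004) §5.9 [BoydVandenberghe2004]; T. Koma, H. Tasaki, J. Stat. Phys. 76 (1994) 745, §1
[KomaTasaki1994]; D. J. Scalapino, S. R. White, S.-C. Zhang, PRB 47 (1993) 7995, §II [ScalapinoWhiteZhang1993]; R. B. Israel, *Convexity in the Theory of
Lattice Gases* (1979) Thm. I.3.4 [Israel1979].
-/

noncomputable section

namespace Summit.Ventures.CertifiedManyBodySolver.Downfold

open Set Filter Topology
open Summit.Ventures.CertifiedManyBodySolver.Observables
open Summit.Ventures.CertifiedManyBodySolver.Certificates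
open Literature.MathematicalPhysics.QuantumLattice Literature.MathematicalPhysics.QuantumLattice.ThermodynamicLimit
open Literature.Probability.LatticeModels
open Matrix HubbardWave0
open scoped BigOperators ComplexOrder

/-! ## §0 The density-affine bundle value and its price on a filling slab -/

/-- **`wnBundleValue F sl₁ sl₂ n₀ x`** `= F + min(sl₁·(x − n₀), sl₂·(x − n₀))`: the value a two-vertex bundle certificate solved at density `n₀` (uniform
floor `F`, vertex density slopes `sl₁`, `sl₂`) certifies at density `x`, uniformly in the bundle parameter. [cite: BoydVandenberghe2004, §5.9] -/
def wnBundleValue (F sl₁ sl₂ n₀ : ℚ) (x : ℝ) : ℝ :=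
  ((F : ℚ) : ℝ) + min (((sl₁ : ℚ) : ℝ) * (x - ((n₀ : ℚ) : ℝ))) (((sl₂ : ℚ) : ℝ) * (x - ((n₀ : ℚ) : ℝ)))

/-- At the solve density the value is `F`. [folklore] -/
theorem wnBundleValue_self (F sl₁ sl₂ n₀ : ℚ) : wnBundleValue F sl₁ sl₂ n₀ ((n₀ : ℚ) : ℝ) = ((F : ℚ) : ℝ) := by
  simp [wnBundleValue]

/-- **PRICE ON A SLAB FROM THE ENDS.** `−wnBundleValue ≤ c` at every `x ∈ [x₁, x₂]` as soon as the four affine end values obey it: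
`−F − sl_j·(x_e − n₀) ≤ c` for `j ∈ {1,2}`, `e ∈ {1,2}` (each branch is affine in `x`). [cite: Israel1979, Thm. I.3.4] -/
theorem neg_wnBundleValue_le_of_ends {F sl₁ sl₂ n₀ c : ℚ} {x₁ x₂ x : ℝ} (hx₁ : x₁ ≤ x) (hx₂ : x ≤ x₂)
    (h₁₁ : -((F : ℚ) : ℝ) - ((sl₁ : ℚ) : ℝ) * (x₁ - ((n₀ : ℚ) : ℝ)) ≤ ((c : ℚ) : ℝ))
    (h₁₂ : -((F : ℚ) : ℝ) - ((sl₁ : ℚ) : ℝ) * (x₂ - ((n₀ : ℚ) : ℝ)) ≤ ((c : ℚ) : ℝ))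
    (h₂₁ : -((F : ℚ) : ℝ) - ((sl₂ : ℚ) : ℝ) * (x₁ - ((n₀ : ℚ) : ℝ)) ≤ ((c : ℚ) : ℝ))
    (h₂₂ : -((F : ℚ) : ℝ) - ((sl₂ : ℚ) : ℝ) * (x₂ - ((n₀ : ℚ) : ℝ)) ≤ ((c : ℚ) : ℝ)) :
    -wnBundleValue F sl₁ sl₂ n₀ x ≤ ((c : ℚ) : ℝ) := by
  unfold wnBundleValue
  -- each branch `−F − sl_j (x − n₀)` is affine in `x`, hence below the max of its end values
  have b₁ : -((F : ℚ) : ℝ) - ((sl₁ : ℚ) : ℝ) * (x - ((n₀ : ℚ) : ℝ)) ≤ ((c : ℚ) : ℝ) := by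
    have h := cfxl_affine_le_max_ends (α := -((F : ℚ) : ℝ) + ((sl₁ : ℚ) : ℝ) * ((n₀ : ℚ) : ℝ)) (β := -((sl₁ : ℚ) : ℝ)) hx₁ hx₂
    have e : ∀ y : ℝ, -((F : ℚ) : ℝ) + ((sl₁ : ℚ) : ℝ) * ((n₀ : ℚ) : ℝ) + -((sl₁ : ℚ) : ℝ) * y =
        -((F : ℚ) : ℝ) - ((sl₁ : ℚ) : ℝ) * (y - ((n₀ : ℚ) : ℝ)) := fun y => by ring
    rw [e, e, e] at h
    exact h.trans (max_le h₁₁ h₁₂)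
  have b₂ : -((F : ℚ) : ℝ) - ((sl₂ : ℚ) : ℝ) * (x - ((n₀ : ℚ) : ℝ)) ≤ ((c : ℚ) : ℝ) := by
    have h := cfxl_affine_le_max_ends (α := -((F : ℚ) : ℝ) + ((sl₂ : ℚ) : ℝ) * ((n₀ : ℚ) : ℝ)) (β := -((sl₂ : ℚ) : ℝ)) hx₁ hx₂
    have e : ∀ y : ℝ, -((F : ℚ) : ℝ) + ((sl₂ : ℚ) : ℝ) * ((n₀ : ℚ) : ℝ) + -((sl₂ : ℚ) : ℝ) * y =
        -((F : ℚ) : ℝ) - ((sl₂ : ℚ) : ℝ) * (y - ((n₀ : ℚ) : ℝ)) := fun y => by ring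
    rw [e, e, e] at h
    exact h.trans (max_le h₂₁ h₂₂)
  rcases le_total (((sl₁ : ℚ) : ℝ) * (x - ((n₀ : ℚ) : ℝ))) (((sl₂ : ℚ) : ℝ) * (x - ((n₀ : ℚ) : ℝ))) with h | h
  · rw [min_eq_left h]; linarith
  · rw [min_eq_right h]; linarith

/-! ## §1 The density-affine bundle claim-node SHAPE -/

/-- **BUNDLE ROW SHAPE, density-affine edition `TPrimeBundleOrbitLowerRowWN U s₁ s₂ lo hi F sl₁ sl₂ n₀ X`** — what a two-vertex `t′`-bundle at the station
`U`, solved at density `n₀` and read with its density multipliers, certifies: for EVERY `s ∈ [s₁, s₂]`, EVERY density `x ∈ [0, 2)` and every torus limit `ω` of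
normalised `(rectN x L, S^z = 0)`-sector ground states of `hubbardTorusTT' L 1 s U`, GIVEN the bundle's constant window rows `lo ≤ e₀(1, s, U, x) ≤ hi`:
`wnBundleValue F sl₁ sl₂ n₀ x ≤ |D₄|⁻¹ Σ_γ Re ω_γ(Γ_γ (X s))`. At `x = n₀` this is the M2(b) shape's conclusion with the constant `F`
(`TPrimeBundleOrbitLowerRow`, box-1). [cite: BoydVandenberghe2004, §5.9] -/
def TPrimeBundleOrbitLowerRowWN (U s₁ s₂ : ℝ) (lo hi F sl₁ sl₂ n₀ : ℚ)
    (X : ℝ → FermionOp (Literature.Probability.LatticeModels.box 2 7)) : Prop :=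
  ∀ s ∈ Set.Icc s₁ s₂, ∀ x : ℝ, 0 ≤ x → x < 2 →
    ∀ (ω : InfVolFermionState 2) (Ls : ℕ → ℕ) (ψ : ∀ L, Fock (Orb (FermionTorus 2 L))),
      Tendsto Ls atTop atTop →
      (∀ j, IsGroundStateInSector (hubbardTorusTT' (Ls j) 1 s U) (rectN x (Ls j)) 0 (ψ (Ls j))) →
      (∀ j, star (ψ (Ls j)) ⬝ᵥ ψ (Ls j) = 1) → ω.IsTorusLimitOf ψ Ls →
      ((lo : ℚ) : ℝ) ≤ energyDensityTT' 1 s U x → energyDensityTT' 1 s U x ≤ ((hi : ℚ) : ℝ) →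
      wnBundleValue F sl₁ sl₂ n₀ x ≤ ((Finset.univ : Finset (DihedralGroup 4)).card : ℝ)⁻¹ *
        ∑ g ∈ (Finset.univ : Finset (DihedralGroup 4)),
          (ω.expect (d4ShiftSet g 0 (Literature.Probability.LatticeModels.box 2 7))
            (fermionEmbed (PolySite.d4Emb g 0 (Literature.Probability.LatticeModels.box 2 7)) (X s))).re

/-! ## §2 SHAPE + discharged window ⇒ the unconditional family on a filling slab -/

/-- **ROW SHAPE ⇒ ORBIT-LOWER FAMILY ON A SLAB.** With the window rows DISCHARGED on `[s₁, s₂] × [xlo, xhi]` (`0 ≤ xlo`, `xhi < 2`; theorems about `e₀` by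
name), the bundle row gives, for every `x ∈ [xlo, xhi]` and `s ∈ [s₁, s₂]`, the unconditional statement `wnBundleValue F sl₁ sl₂ n₀ x ≤ |D₄|⁻¹ Σ_γ Re ω_γ(Γ_γ (X s))`
on the torus-limit ground-state class at `(s, U, x)` — the hypothesis shape of the doped apex closers (`…_targetSlot…_doped`, `…_twoEndObjectives_doped`).
[cite: KomaTasaki1994, §1] -/
theorem TPrimeBundleOrbitLowerRowWN.orbitLowerOn {U s₁ s₂ : ℝ} {lo hi F sl₁ sl₂ n₀ : ℚ}
    {X : ℝ → FermionOp (Literature.Probability.LatticeModels.box 2 7)} (h : TPrimeBundleOrbitLowerRowWN U s₁ s₂ lo hi F sl₁ sl₂ n₀ X)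
    {xlo xhi : ℝ} (hx0 : 0 ≤ xlo) (hx2 : xhi < 2)
    (hlo : ∀ s ∈ Set.Icc s₁ s₂, ∀ x ∈ Set.Icc xlo xhi, ((lo : ℚ) : ℝ) ≤ energyDensityTT' 1 s U x)
    (hhi : ∀ s ∈ Set.Icc s₁ s₂, ∀ x ∈ Set.Icc xlo xhi, energyDensityTT' 1 s U x ≤ ((hi : ℚ) : ℝ)) :
    ∀ x ∈ Set.Icc xlo xhi, ∀ s ∈ Set.Icc s₁ s₂,
      ∀ (ω : InfVolFermionState 2) (Ls : ℕ → ℕ) (ψ : ∀ L, Fock (Orb (FermionTorus 2 L))),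
      Tendsto Ls atTop atTop →
      (∀ j, IsGroundStateInSector (hubbardTorusTT' (Ls j) 1 s U) (rectN x (Ls j)) 0 (ψ (Ls j))) →
      (∀ j, star (ψ (Ls j)) ⬝ᵥ ψ (Ls j) = 1) → ω.IsTorusLimitOf ψ Ls →
      wnBundleValue F sl₁ sl₂ n₀ x ≤ ((Finset.univ : Finset (DihedralGroup 4)).card : ℝ)⁻¹ *
        ∑ g ∈ (Finset.univ : Finset (DihedralGroup 4)),
          (ω.expect (d4ShiftSet g 0 (Literature.Probability.LatticeModels.box 2 7))
            (fermionEmbed (PolySite.d4Emb g 0 (Literature.Probability.LatticeModels.box 2 7)) (X s))).re :=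
  fun x hx s hs ω Ls ψ hLs hψ h1 hω =>
    h s hs x (hx0.trans hx.1) (lt_of_le_of_lt hx.2 hx2) ω Ls ψ hLs hψ h1 hω (hlo s hs x hx) (hhi s hs x hx)

/-! ## §3 M2(c): the parametric closer from FOUR end-objective station bundles (`U_A = 29/5`, `n₀ = 7/8`) -/

/-- **M2(c) «LSCO x = 1/8» FROM FOUR DENSITY-AFFINE BUNDLE ROWS.** Objectives `P = −X₀(−3/10, 29/5)` and `Q = −X₀(−1/5, 29/5)`; segments OVERHANG
`[−357/740, −3/10]` (rows `Po`, `Qo`, window `lo_o ≤ e₀ ≤ hi`) and INNER `[−3/10, −1/5]` (rows `Pi`, `Qi`, window `lo_i ≤ e₀ ≤ hi`) at the station `U = 29/5`, solved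
at `n₀ = 7/8`; windows discharged on the segments × the M15 slab `[171/200, 179/200]` (ONE cap `hi` for the whole station segment — e.g.
`u29o5_slab_stationSegment_cap_of` — and one floor per segment); the sixteen end prices `−F_b − sl_bj·(x_e − 7/8) ≤ c`; `c ≤ 4017332/10⁷`. Then
`La214M2c_StiffnessBoxCeiling` (`…_of_apexStation29o5_twoEndObjectives` with `vP x s = if s ≤ −3/10 then wnBundleValue Po x else wnBundleValue Pi x`, likewise `vQ`;
on the `σ`-chord the price is the convex combination of the two end prices). CONDITIONAL on the four rows and the window theorems plugged in; no number asserted.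
[cite: KomaTasaki1994, §1] [cite: ScalapinoWhiteZhang1993, §II] [cite: BoydVandenberghe2004, §5.9] -/
theorem La214M2c_StiffnessBoxCeiling_of_fourBundleRowsWN
    (lo_o lo_i hi FPo sPo₁ sPo₂ FPi sPi₁ sPi₂ FQo sQo₁ sQo₂ FQi sQi₁ sQi₂ c : ℚ) (hbar : c ≤ 4017332 / 10000000)
    (hPo : TPrimeBundleOrbitLowerRowWN (29 / 5) (-(357 / 740)) (-3 / 10) lo_o hi FPo sPo₁ sPo₂ (7 / 8)
      (fun _ => -oddMomentObsTT (-3 / 10) (29 / 5) 0))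
    (hPi : TPrimeBundleOrbitLowerRowWN (29 / 5) (-3 / 10) (-1 / 5) lo_i hi FPi sPi₁ sPi₂ (7 / 8)
      (fun _ => -oddMomentObsTT (-3 / 10) (29 / 5) 0))
    (hQo : TPrimeBundleOrbitLowerRowWN (29 / 5) (-(357 / 740)) (-3 / 10) lo_o hi FQo sQo₁ sQo₂ (7 / 8)
      (fun _ => -oddMomentObsTT (-1 / 5) (29 / 5) 0))
    (hQi : TPrimeBundleOrbitLowerRowWN (29 / 5) (-3 / 10) (-1 / 5) lo_i hi FQi sQi₁ sQi₂ (7 / 8)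
      (fun _ => -oddMomentObsTT (-1 / 5) (29 / 5) 0))
    (hlo_o : ∀ s ∈ Set.Icc (-(357 / 740) : ℝ) (-3 / 10), ∀ x ∈ Set.Icc (171 / 200 : ℝ) (179 / 200),
      ((lo_o : ℚ) : ℝ) ≤ energyDensityTT' 1 s (29 / 5) x)
    (hlo_i : ∀ s ∈ Set.Icc (-3 / 10 : ℝ) (-1 / 5), ∀ x ∈ Set.Icc (171 / 200 : ℝ) (179 / 200),
      ((lo_i : ℚ) : ℝ) ≤ energyDensityTT' 1 s (29 / 5) x)
    (hhi : ∀ s ∈ Set.Icc (-(357 / 740) : ℝ) (-1 / 5), ∀ x ∈ Set.Icc (171 / 200 : ℝ) (179 / 200),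
      energyDensityTT' 1 s (29 / 5) x ≤ ((hi : ℚ) : ℝ))
    (pPo : -FPo - sPo₁ * (171 / 200 - 7 / 8) ≤ c ∧ -FPo - sPo₁ * (179 / 200 - 7 / 8) ≤ c ∧
      -FPo - sPo₂ * (171 / 200 - 7 / 8) ≤ c ∧ -FPo - sPo₂ * (179 / 200 - 7 / 8) ≤ c)
    (pPi : -FPi - sPi₁ * (171 / 200 - 7 / 8) ≤ c ∧ -FPi - sPi₁ * (179 / 200 - 7 / 8) ≤ c ∧
      -FPi - sPi₂ * (171 / 200 - 7 / 8) ≤ c ∧ -FPi - sPi₂ * (179 / 200 - 7 / 8) ≤ c)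
    (pQo : -FQo - sQo₁ * (171 / 200 - 7 / 8) ≤ c ∧ -FQo - sQo₁ * (179 / 200 - 7 / 8) ≤ c ∧
      -FQo - sQo₂ * (171 / 200 - 7 / 8) ≤ c ∧ -FQo - sQo₂ * (179 / 200 - 7 / 8) ≤ c)
    (pQi : -FQi - sQi₁ * (171 / 200 - 7 / 8) ≤ c ∧ -FQi - sQi₁ * (179 / 200 - 7 / 8) ≤ c ∧
      -FQi - sQi₂ * (171 / 200 - 7 / 8) ≤ c ∧ -FQi - sQi₂ * (179 / 200 - 7 / 8) ≤ c) :
    La214M2c_StiffnessBoxCeiling := by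
  -- the window of each segment on the slab
  have hhi_o : ∀ s ∈ Set.Icc (-(357 / 740) : ℝ) (-3 / 10), ∀ x ∈ Set.Icc (171 / 200 : ℝ) (179 / 200),
      energyDensityTT' 1 s (29 / 5) x ≤ ((hi : ℚ) : ℝ) :=
    fun s hs x hx => hhi s ⟨hs.1, hs.2.trans (by norm_num)⟩ x hx
  have hhi_i : ∀ s ∈ Set.Icc (-3 / 10 : ℝ) (-1 / 5), ∀ x ∈ Set.Icc (171 / 200 : ℝ) (179 / 200),
      energyDensityTT' 1 s (29 / 5) x ≤ ((hi : ℚ) : ℝ) :=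
    fun s hs x hx => hhi s ⟨le_trans (by norm_num) hs.1, hs.2⟩ x hx
  -- the four unconditional families
  have fPo := hPo.orbitLowerOn (by norm_num) (by norm_num) hlo_o hhi_o
  have fPi := hPi.orbitLowerOn (by norm_num) (by norm_num) hlo_i hhi_i
  have fQo := hQo.orbitLowerOn (by norm_num) (by norm_num) hlo_o hhi_o
  have fQi := hQi.orbitLowerOn (by norm_num) (by norm_num) hlo_i hhi_i
  -- prices on the slab (real form of the sixteen rational end inequalities)
  have cast4 : ∀ {F sl : ℚ} {e : ℚ}, -F - sl * (e - 7 / 8) ≤ c →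
      -((F : ℚ) : ℝ) - ((sl : ℚ) : ℝ) * (((e : ℚ) : ℝ) - (((7 / 8 : ℚ)) : ℝ)) ≤ ((c : ℚ) : ℝ) := by
    intro F sl e h; exact_mod_cast h
  have e171 : (((171 / 200 : ℚ)) : ℝ) = 171 / 200 := by push_cast; ring
  have e179 : (((179 / 200 : ℚ)) : ℝ) = 179 / 200 := by push_cast; ring
  have price : ∀ {F sl₁ sl₂ : ℚ}, (-F - sl₁ * (171 / 200 - 7 / 8) ≤ c ∧ -F - sl₁ * (179 / 200 - 7 / 8) ≤ c ∧
      -F - sl₂ * (171 / 200 - 7 / 8) ≤ c ∧ -F - sl₂ * (179 / 200 - 7 / 8) ≤ c) →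
      ∀ x ∈ Set.Icc (171 / 200 : ℝ) (179 / 200), -wnBundleValue F sl₁ sl₂ (7 / 8) x ≤ ((c : ℚ) : ℝ) := by
    intro F sl₁ sl₂ hp x hx
    obtain ⟨a, b, d, e⟩ := hp
    have a' := cast4 a; have b' := cast4 b; have d' := cast4 d; have e' := cast4 e
    rw [e171] at a' d'; rw [e179] at b' e'
    exact neg_wnBundleValue_le_of_ends hx.1 hx.2 a' b' d' e'
  have cPo := price pPo; have cPi := price pPi; have cQo := price pQo; have cQi := price pQi
  -- the piecewise families
  refine La214M2c_StiffnessBoxCeiling_of_apexStation29o5_twoEndObjectives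
    (fun x s => if s ≤ -3 / 10 then wnBundleValue FPo sPo₁ sPo₂ (7 / 8) x else wnBundleValue FPi sPi₁ sPi₂ (7 / 8) x)
    (fun x s => if s ≤ -3 / 10 then wnBundleValue FQo sQo₁ sQo₂ (7 / 8) x else wnBundleValue FQi sQi₁ sQi₂ (7 / 8) x)
    c hbar ?_ ?_ ?_
  · intro x hx s hs ω Ls ψ hLs hψ h1 hω
    by_cases h3 : s ≤ -3 / 10
    · simp only [if_pos h3]
      exact fPo x hx s ⟨hs.1, h3⟩ ω Ls ψ hLs hψ h1 hω
    · simp only [if_neg h3]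
      exact fPi x hx s ⟨(not_le.1 h3).le, hs.2⟩ ω Ls ψ hLs hψ h1 hω
  · intro x hx s hs ω Ls ψ hLs hψ h1 hω
    by_cases h3 : s ≤ -3 / 10
    · simp only [if_pos h3]
      exact fQo x hx s ⟨hs.1, h3⟩ ω Ls ψ hLs hψ h1 hω
    · simp only [if_neg h3]
      exact fQi x hx s ⟨(not_le.1 h3).le, hs.2⟩ ω Ls ψ hLs hψ h1 hω
  · -- σ-chord price: a convex combination of two quantities each `≥ −c`
    intro x hx σ hσ s hs
    have hw₁ : 0 ≤ (-1 / 5 - σ) / (-1 / 5 - -3 / 10 : ℝ) := div_nonneg (by linarith [hσ.2]) (by norm_num)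
    have hw₂ : 0 ≤ (σ - -3 / 10) / (-1 / 5 - -3 / 10 : ℝ) := div_nonneg (by linarith [hσ.1]) (by norm_num)
    have hws : (-1 / 5 - σ) / (-1 / 5 - -3 / 10 : ℝ) + (σ - -3 / 10) / (-1 / 5 - -3 / 10) = 1 := by
      field_simp; ring
    have hP' : -(if s ≤ -3 / 10 then wnBundleValue FPo sPo₁ sPo₂ (7 / 8) x else wnBundleValue FPi sPi₁ sPi₂ (7 / 8) x) ≤ ((c : ℚ) : ℝ) := by
      by_cases h3 : s ≤ -3 / 10
      · simp only [if_pos h3]; exact cPo x hx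
      · simp only [if_neg h3]; exact cPi x hx
    have hQ' : -(if s ≤ -3 / 10 then wnBundleValue FQo sQo₁ sQo₂ (7 / 8) x else wnBundleValue FQi sQi₁ sQi₂ (7 / 8) x) ≤ ((c : ℚ) : ℝ) := by
      by_cases h3 : s ≤ -3 / 10
      · simp only [if_pos h3]; exact cQo x hx
      · simp only [if_neg h3]; exact cQi x hx
    set vp := (if s ≤ -3 / 10 then wnBundleValue FPo sPo₁ sPo₂ (7 / 8) x else wnBundleValue FPi sPi₁ sPi₂ (7 / 8) x) with hvp
    set vq := (if s ≤ -3 / 10 then wnBundleValue FQo sQo₁ sQo₂ (7 / 8) x else wnBundleValue FQi sQi₁ sQi₂ (7 / 8) x) with hvq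
    set w₁ := (-1 / 5 - σ) / (-1 / 5 - -3 / 10 : ℝ) with hw₁def
    set w₂ := (σ - -3 / 10) / (-1 / 5 - -3 / 10 : ℝ) with hw₂def
    have k₁ := mul_le_mul_of_nonneg_left hP' hw₁
    have k₂ := mul_le_mul_of_nonneg_left hQ' hw₂
    have : -(w₁ * vp + w₂ * vq) = w₁ * (-vp) + w₂ * (-vq) := by ring
    rw [this]
    calc w₁ * (-vp) + w₂ * (-vq) ≤ w₁ * ((c : ℚ) : ℝ) + w₂ * ((c : ℚ) : ℝ) := add_le_add k₁ k₂
      _ = ((c : ℚ) : ℝ) := by rw [← add_mul, hws, one_mul]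

end Summit.Ventures.CertifiedManyBodySolver.Downfold

end
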